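import Literature.AlgebraicGeometry.Pohlmann1968.HodgeClassesCMType
import Mathlib.LinearAlgebra.Lagrange
import Mathlib.LinearAlgebra.Eigenspace.Minpoly
import HarnessLib

/-!
# The Hodge type projectors of an abelian variety of CM type are polynomials in the pull-back by ONE endomorphism (proved)

Research context: cell `pub-hodge-ring2` (a route conditional on HC_CM); this file is an
unconditional theorem about CM-type realisations and no step towards a summit statement. It is
brick E12b (the "torus side") of the Literature lane's formalisation of Hazama / Moonen–Zarhin
(3.2)(2) «`X₁` without factors of type IV satisfying (D), `X₂` of CM type ⟹
`Hg(X₁ × X₂) = Hg(X₁) × Hg(X₂)`» read on Hodge classes; brick E12a is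
`RepresentationTheory/GeneralLinear/TorusSl2ProductSplitting` (whose torus block asks for exactly the
output of this file: the Hodge grading of `Hᵈ(A(ℂ); ℂ)` as a `ℂ`-combination of powers of one
RATIONAL endomorphism).

## The statement

Let `(A, ι, θ)` realise a CM type `(K; Φ)` (`ComplexMultiplication.IsCMTypeRealisation`: `K` a number
field acting through `ι : 𝓞_K → End A`, `H¹(A(ℂ); ℂ) = ⊕_{σ : K → ℂ} H¹_σ` with `H¹_σ` a line of type
`(1,0)` for `σ ∈ Φ` and `(0,1)` otherwise). Then there is ONE `u ∈ 𝓞_K` such that for every degree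
`d`, every Hodge model `M` of `A` and every `(p, q)`, `p + q = d`, the projector
`π_{(p,q)} : Hᵈ(A(ℂ); ℂ) → Hᵈ(A(ℂ); ℂ)` onto the classes of type `(p, q)` is a `ℂ`-linear combination
of the powers `((ι u)^*)^k`, `k < #{d-subsets of Hom(K, ℂ)}`, of the pull-back `(ι u)^*` on `Hᵈ`
(`exists_typeProj_mem_span_pow`); so is every `ℂ`-combination of the projectors, e.g. the Hodge
grading `∑ (p - q) π_{(p,q)}` (`sum_smul_typeProj_mem_span_pow`).

This is the content of Milne's remark 1.2 / Gordon §9.2 / Pohlmann §1 that for a CM abelian variety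
"the Hodge structure is determined by the action of `K`": the Mumford–Tate torus lies in
`Res_{K/ℚ} 𝔾_m` acting through `ι`, so the Hodge cocharacter — hence every type projector — is a
function of the `K`-action; on `Hᵈ = ⋀ᵈ H¹` with the eigen-monomial basis `v_S = ∧_{σ ∈ S} v_σ`
(`|S| = d`), `(ι u)^* v_S = (∏_{σ∈S} σ u) v_S` and `v_S` has type `(|S ∩ Φ|, |S ∖ Φ|)`, and for `u`
SEPARATING (the eigen-monomials `∏_{σ ∈ S} σ u` pairwise distinct, `exists_separating`) the Lagrange
interpolation polynomials at these nodes cut out each `ℂ v_S`, so `π_{(p,q)} = ∑_{type S = (p,q)} L_S((ι u)^*)`.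
[cite: Milne2020HodgeClassesAV, 1.2 (a)–(b)] [cite: Gordon1999HodgeAVSurvey, §9.2]
[cite: MoonenZarhin1999LowDim, Thm. (3.2)(2)] [cite: Pohlmann1968, §1]

## Proof (followed as printed in Gordon §9.2 / Milne 1.2, with Lagrange interpolation for the last step)

(1) a separating `u ∈ 𝓞_K` (`exists_separating'`, a private copy of the private lemma of `HodgeClassesCMType`) and the eigenbasis `v_σ` of `H¹` (`exists_eigenbasis`); (2) the monomial basis `b_S` of `Hᵈ`
(`exists_monomialBasis`) with `(ι u)^* b_S = (∏_{σ ∈ S} σ u) • b_S` (`map_monomial_eq_prod_smul`) and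
`b_S` of type `(|S ∩ Φ|, |S ∖ Φ|)` (`isOfHodgeType_monomial`), hence in that type piece of ANY model
(`HodgeModel.mem_typePiece_of_isOfHodgeType`, the tree's theorem `hodgePQ_independent_of_hodgeModel_holds`);
(3) `Q := ∑_{type S = (p,q)} aeval ((ι u)^*) (Lagrange.basis _ ev S)` agrees with `π_{(p,q)}` on every
`b_T` (`Module.End.aeval_apply_of_mem_apply_eq_smul`, `Lagrange.eval_basis_self/of_ne` against
`typeProj_apply_of_mem(_ne)`), so `Q = π_{(p,q)}` (`Basis.ext`); (4) each Lagrange polynomial has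
degree `< #nodes` (`Lagrange.natDegree_basis`), so `aeval` of it is a combination of the powers
`((ι u)^*)^k`, `k < #nodes` (`Polynomial.aeval_eq_sum_range'`).

## References
* [Milne2020HodgeClassesAV] J. S. Milne, *The Hodge conjecture for abelian varieties* (notes, 2020), 1.2.
* [Gordon1999HodgeAVSurvey] B. B. Gordon, *A survey of the Hodge conjecture for abelian varieties*,
  Appendix B in J. D. Lewis, *A Survey of the Hodge Conjecture*, CRM Monogr. Ser. 10 (1999), §9.2.
* [MoonenZarhin1999LowDim] B. Moonen, Yu. Zarhin, *Hodge classes on abelian varieties of low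
  dimension*, Math. Ann. 315 (1999), Thm. (3.2)(2).
* [Pohlmann1968] H. Pohlmann, *Algebraic cycles on abelian varieties of complex multiplication type*,
  Ann. of Math. 88 (1968), §1.
-/


noncomputable section

open CategoryTheory NumberField Module Polynomial
open Literature.AlgebraicGeometry.Motives (AbelianVariety CMType IsSmoothProjective ComplexPoints)
open Literature.AlgebraicGeometry.HodgeTheory
open Literature.AlgebraicGeometry.ComplexMultiplication (IsCMTypeRealisation)
open Literature.NumberTheory.Automorphic.PicardCM (eigenline)

namespace Literature.AlgebraicGeometry.Pohlmann1968

/-! ### A separating integral element (copy of the private lemma of `HodgeClassesCMType`) -/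

/-- **A separating integral element**: some `u ∈ 𝓞_K` has pairwise distinct eigen-monomials
`∏_{σ ∈ s} σ(u)` over ALL finite sets `s ⊆ Hom(K, ℂ)` (take `u = a + N` with `a` an integral
primitive element and `N ∈ ℕ` avoiding the finitely many roots of the differences
`∏_{σ ∈ s} (X + σ a) - ∏_{σ ∈ t} (X + σ a)`, `s ≠ t`). [folklore] -/
private theorem exists_separating' (K : Type) [Field K] [NumberField K] :
    ∃ u : 𝓞 K, Function.Injective fun s : Finset (K →+* ℂ) => ∏ σ ∈ s, σ (u : K) := by
  classical
  -- an integral primitive element `a`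
  obtain ⟨α, hα⟩ := Field.exists_primitive_element ℚ K
  have hinjα : Function.Injective fun φ : K →ₐ[ℚ] ℂ => φ α :=
    (Field.primitive_element_iff_algHom_eq_of_eval' ℚ ℂ (fun x => IsAlgClosed.splits _) α).1 hα
  have hαℤ : IsAlgebraic ℤ α :=
    (IsFractionRing.isAlgebraic_iff ℤ ℚ K).2 (Algebra.IsAlgebraic.isAlgebraic α)
  obtain ⟨m, a, hm, hma⟩ := hαℤ.exists_nsmul_eq (𝓞 K)
  have hinja : Function.Injective fun σ : K →+* ℂ => σ (a : K) := by
    intro σ σ' h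
    have h' : σ α = σ' α := by
      have hσ : σ (a : K) = (m : ℂ) * σ α := by
        rw [show ((a : 𝓞 K) : K) = m • α from hma.symm, nsmul_eq_mul, map_mul, map_natCast]
      have hσ' : σ' (a : K) = (m : ℂ) * σ' α := by
        rw [show ((a : 𝓞 K) : K) = m • α from hma.symm, nsmul_eq_mul, map_mul, map_natCast]
      have hh : (m : ℂ) * σ α = (m : ℂ) * σ' α := by rw [← hσ, ← hσ']; exact h
      exact mul_left_cancel₀ (Nat.cast_ne_zero.2 hm) hh
    have h'' := hinjα (show (fun φ : K →ₐ[ℚ] ℂ => φ α) σ.toRatAlgHom =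
      (fun φ : K →ₐ[ℚ] ℂ => φ α) σ'.toRatAlgHom from h')
    rw [← RingHom.toRatAlgHom_toRingHom σ, ← RingHom.toRatAlgHom_toRingHom σ', h'']
  -- the polynomials `p s = ∏_{σ ∈ s} (X + σ a)` are pairwise distinct
  set w : (K →+* ℂ) → ℂ := fun σ => -σ (a : K) with hw_def
  have hw : Function.Injective w := fun σ σ' h => hinja (neg_injective h)
  set pp : Finset (K →+* ℂ) → ℂ[X] := fun s => ∏ σ ∈ s, (X - C (w σ)) with hpp_def
  have hroots : ∀ s, (pp s).roots = s.val.map w := fun s => by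
    rw [hpp_def]
    simp only
    rw [Finset.prod_eq_multiset_prod,
      show (fun σ => X - C (w σ)) = (fun z => X - C z) ∘ w from rfl, ← Multiset.map_map,
      Polynomial.roots_multiset_prod_X_sub_C]
  have hpinj : Function.Injective pp := fun s t h =>
    Finset.val_injective (Multiset.map_injective hw (by rw [← hroots, ← hroots, h]))
  -- avoid the finitely many bad shifts
  set bad : Finset ℂ := (Finset.univ : Finset (Finset (K →+* ℂ) × Finset (K →+* ℂ))).biUnion
    fun st => (pp st.1 - pp st.2).roots.toFinset with hbad_def
  obtain ⟨N, hN⟩ : ∃ N : ℕ, (N : ℂ) ∉ bad := by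
    by_contra h
    simp only [not_exists, not_not] at h
    exact Set.Infinite.mono (Set.range_subset_iff.2 fun N => (Finset.mem_coe.2 (h N)))
      (Set.infinite_range_of_injective (Nat.cast_injective (R := ℂ))) bad.finite_toSet
  refine ⟨a + N, fun s t hst => ?_⟩
  -- `∏_{σ ∈ s} σ(a + N) = (pp s)(N)`
  have heval : ∀ s : Finset (K →+* ℂ), ∏ σ ∈ s, σ (((a + N : 𝓞 K) : K)) = (pp s).eval (N : ℂ) := by
    intro s
    rw [hpp_def]
    simp only
    rw [Polynomial.eval_prod]
    refine Finset.prod_congr rfl fun σ _ => ?_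
    rw [hw_def, RingOfIntegers.coe_eq_algebraMap, map_add, map_natCast, map_add, map_natCast,
      Polynomial.eval_sub, Polynomial.eval_X, Polynomial.eval_C, sub_neg_eq_add, add_comm]
  by_contra hne
  have hp : pp s - pp t ≠ 0 := sub_ne_zero.2 fun h => hne (hpinj h)
  apply hN
  rw [hbad_def, Finset.mem_biUnion]
  refine ⟨(s, t), Finset.mem_univ _, ?_⟩
  rw [Multiset.mem_toFinset, Polynomial.mem_roots hp, Polynomial.IsRoot, Polynomial.eval_sub,
    sub_eq_zero, ← heval, ← heval]
  exact hst

/-! ### Lagrange interpolation cuts out eigenlines -/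

section Lagrange

variable {k : Type*} [Field k] {V : Type*} [AddCommGroup V] [Module k V]
  {S : Type*} [Fintype S] [DecidableEq S]

/-- **A combination of powers**: for `p` of degree `< N`, `aeval f p` is a `k`-combination of the
powers `f^i`, `i < N`. [folklore] -/
private theorem aeval_mem_span_pow (f : Module.End k V) {p : k[X]} {N : ℕ} (hp : p.natDegree < N) :
    aeval f p ∈ Submodule.span k (Set.range fun i : Fin N => f ^ (i : ℕ)) := by
  rw [aeval_eq_sum_range' hp]
  refine Submodule.sum_mem _ fun i hi => Submodule.smul_mem _ _ ?_
  exact Submodule.subset_span ⟨⟨i, Finset.mem_range.1 hi⟩, rfl⟩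

/-- **Lagrange interpolation cuts out the eigenvectors of an endomorphism diagonal in a basis with
nodes `ev`**: if `f (b s) = ev s • b s` with `ev` injective, then for any set `T` of indices the
operator `∑_{s ∈ T} L_s(f)` (`L_s` the Lagrange basis polynomial at the node `ev s`) is the
projector onto `span {b s : s ∈ T}` along the other `b s`: it fixes `b t` for `t ∈ T` and kills
`b t` for `t ∉ T`. [folklore] -/
private theorem sum_aeval_lagrange_basis_apply (b : Basis S k V) (f : Module.End k V) {ev : S → k}
    (hev : Function.Injective ev) (hfb : ∀ s, f (b s) = ev s • b s) (T : Finset S) (t : S) :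
    (∑ s ∈ T, aeval f (Lagrange.basis Finset.univ ev s)) (b t) = if t ∈ T then b t else 0 := by
  rw [LinearMap.sum_apply]
  have hterm : ∀ s, aeval f (Lagrange.basis Finset.univ ev s) (b t) = if s = t then b t else 0 := by
    intro s
    rw [Module.End.aeval_apply_of_mem_apply_eq_smul (hfb t)]
    by_cases hst : s = t
    · subst hst
      rw [Lagrange.eval_basis_self (hev.injOn.mono (Set.subset_univ _)) (Finset.mem_univ _),
        one_smul, if_pos rfl]
    · rw [Lagrange.eval_basis_of_ne hst (Finset.mem_univ _), zero_smul, if_neg hst]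
  simp_rw [hterm]
  rw [Finset.sum_ite_eq' T t]

/-- The projector of `sum_aeval_lagrange_basis_apply` is a combination of the powers `f^i`,
`i < #S`. [folklore] -/
private theorem sum_aeval_lagrange_basis_mem_span_pow (f : Module.End k V) {ev : S → k}
    (hev : Function.Injective ev) (T : Finset S) :
    (∑ s ∈ T, aeval f (Lagrange.basis Finset.univ ev s)) ∈
      Submodule.span k (Set.range fun i : Fin (Fintype.card S) => f ^ (i : ℕ)) := by
  refine Submodule.sum_mem _ fun s _ => aeval_mem_span_pow f ?_
  rw [Lagrange.natDegree_basis (hev.injOn.mono (Set.subset_univ _)) (Finset.mem_univ s),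
    Finset.card_univ]
  have : 0 < Fintype.card S := Fintype.card_pos_iff.2 ⟨s⟩
  omega

end Lagrange

/-! ### The theorem -/

section CMTypeOf

variable {K : Type} [Field K]

/-- The Hodge type of a `d`-set `s ⊆ Hom(K, ℂ)` relative to the CM type `Φ`: `(|s ∩ Φ|, |s ∖ Φ|)`,
a point of the antidiagonal of `d`. [cite: Milne2020HodgeClassesAV, 1.2 (b)] -/
def cmTypeOf (Φ : CMType K) (d : ℕ) (s : Set.powersetCard (K →+* ℂ) d) :
    ↥(Finset.HasAntidiagonal.antidiagonal d) :=
  ⟨({i | i ∈ (s : Finset (K →+* ℂ)) ∧ i ∈ Φ.1}.ncard, {i | i ∈ (s : Finset (K →+* ℂ)) ∧ i ∉ Φ.1}.ncard), by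
    classical
    rw [Finset.HasAntidiagonal.mem_antidiagonal,
      show {i | i ∈ (s : Finset (K →+* ℂ)) ∧ i ∈ Φ.1} = ↑((s : Finset (K →+* ℂ)).filter (· ∈ Φ.1)) by
        rw [Finset.coe_filter],
      show {i | i ∈ (s : Finset (K →+* ℂ)) ∧ i ∉ Φ.1} = ↑((s : Finset (K →+* ℂ)).filter (· ∉ Φ.1)) by
        rw [Finset.coe_filter],
      Set.ncard_coe_finset, Set.ncard_coe_finset, Finset.card_filter_add_card_filter_not,
      Set.powersetCard.card_eq]⟩

/-- The components of `cmTypeOf`: `(|s ∩ Φ|, |s ∖ Φ|)`. [cite: Milne2020HodgeClassesAV, 1.2 (b)] -/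
theorem cmTypeOf_val (Φ : CMType K) (d : ℕ) (s : Set.powersetCard (K →+* ℂ) d) :
    (cmTypeOf Φ d s).1 = ({i | i ∈ (s : Finset (K →+* ℂ)) ∧ i ∈ Φ.1}.ncard,
      {i | i ∈ (s : Finset (K →+* ℂ)) ∧ i ∉ Φ.1}.ncard) :=
  rfl

end CMTypeOf

section CMType

variable {K : Type} [Field K] [NumberField K] {Φ : CMType K} {A : AbelianVariety ℂ}
  {ι : 𝓞 K →+* End A} {θ : K →+* Module.End ℂ (complexBetti A.X 1)}

/-- **The type projectors of a CM abelian variety are polynomials in ONE pull-back `(ι u)^*`.**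
For a realisation `(A, ι, θ)` of a CM type `(K; Φ)` there is `u ∈ 𝓞_K` such that for every degree
`d`, every Hodge model `M` of `A` and every `(p, q)` with `p + q = d`, the projector `π_{(p,q)}` of
`Hᵈ(A(ℂ); ℂ)` lies in the `ℂ`-span of the powers `((ι u)^*|_{Hᵈ})^k`, `k < #{d-subsets of Hom(K, ℂ)}`.
(Milne 1.2 (a)–(b) / Gordon §9.2: `Hᵈ = ⊕_S ℂ v_S` with `(ι u)^* v_S = (∏_{σ ∈ S} σ u) v_S`, `v_S` of type
`(|S ∩ Φ|, |S ∖ Φ|)`; `u` separating; Lagrange interpolation at the nodes `∏_{σ ∈ S} σ u`.)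
[cite: Milne2020HodgeClassesAV, 1.2 (a)–(b)] [cite: Gordon1999HodgeAVSurvey, §9.2]
[cite: MoonenZarhin1999LowDim, Thm. (3.2)(2)] -/
theorem exists_typeProj_mem_span_pow (hA : IsCMTypeRealisation Φ A ι θ) :
    ∃ u : 𝓞 K, ∀ (d : ℕ) (M : HodgeModel (Module.finrank ℚ K / 2) A.X)
      (pq : ↥(Finset.HasAntidiagonal.antidiagonal d)),
      M.typeProj d pq ∈ Submodule.span ℂ (Set.range fun k : Fin (Fintype.card (Set.powersetCard (K →+* ℂ) d)) =>
        (complexBetti.map (ι u).hom.hom.hom d).hom ^ (k : ℕ)) := by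
  classical
  have hX : IsSmoothProjective (Module.finrank ℚ K / 2) A.X := hA.1
  have hI := hodgePQ_independent_of_hodgeModel_holds
  -- (1) a separating integral element and the eigenbasis of `H¹`
  obtain ⟨u, hu⟩ := exists_separating' K
  have hu1 : Function.Injective fun σ : K →+* ℂ => σ (u : K) := fun σ σ' h => by
    have h' : ({σ} : Finset (K →+* ℂ)) = {σ'} :=
      hu (by simpa only [Finset.prod_singleton] using h)
    exact Finset.singleton_injective h'
  obtain ⟨v, hv⟩ := exists_eigenbasis hA hu1
  have hvl : ∀ σ, v σ ∈ eigenline θ σ := fun σ =>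
    (Submodule.mem_iInf _).2 fun a => Module.End.mem_eigenspace_iff.2 (hv σ a)
  have hθ : ∀ (a : 𝓞 K) (σ : K →+* ℂ),
      complexBetti.map (ι a).hom.hom.hom 1 (v σ) = σ (a : K) • v σ := fun a σ => by
    rw [show complexBetti.map (ι a).hom.hom.hom 1 (v σ) =
      (complexBetti.map (ι a).hom.hom.hom 1).hom (v σ) from rfl, hA.2.2.1 a]
    exact hv σ a
  have hv10 : ∀ σ, (fun σ : K →+* ℂ => σ ∈ Φ.1) σ →
      IsOfHodgeType (Module.finrank ℚ K / 2) A.X 1 1 0 (v σ) :=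
    fun σ hσ => (hA.2.2.2 σ).2.1 hσ (v σ) (hvl σ)
  have hv01 : ∀ σ, ¬ (fun σ : K →+* ℂ => σ ∈ Φ.1) σ →
      IsOfHodgeType (Module.finrank ℚ K / 2) A.X 1 0 1 (v σ) :=
    fun σ hσ => (hA.2.2.2 σ).2.2 hσ (v σ) (hvl σ)
  refine ⟨u, fun d M pq => ?_⟩
  -- (2) the monomial basis of `Hᵈ`, eigenvalues and types
  letI : LinearOrder (K →+* ℂ) :=
    LinearOrder.lift' (Fintype.equivFin (K →+* ℂ)) (Fintype.equivFin (K →+* ℂ)).injective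
  obtain ⟨b, hb⟩ := exists_monomialBasis v d
  set f : Module.End ℂ (complexBetti A.X d) := (complexBetti.map (ι u).hom.hom.hom d).hom with hf_def
  set ev : Set.powersetCard (K →+* ℂ) d → ℂ := fun s => ∏ σ ∈ (s : Finset (K →+* ℂ)), σ (u : K)
    with hev_def
  have hev : Function.Injective ev := fun s t hst => Subtype.ext (hu hst)
  have hfb : ∀ s, f (b s) = ev s • b s := fun s => by
    rw [hf_def, show (complexBetti.map (ι u).hom.hom.hom d).hom (b s) =
      complexBetti.map (ι u).hom.hom.hom d (b s) from rfl]
    exact map_monomial_eq_prod_smul hb _ (hθ u) s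
  have hbt : ∀ s, b s ∈ M.typePiece d (cmTypeOf Φ d s) := fun s =>
    M.mem_typePiece_of_isOfHodgeType hI hX _
      (isOfHodgeType_monomial hX hb (fun σ : K →+* ℂ => σ ∈ Φ.1) hv10 hv01 s)
  -- (3) the Lagrange projector onto the monomials of type `pq` is `π_pq`
  set T : Finset (Set.powersetCard (K →+* ℂ) d) := Finset.univ.filter fun s => cmTypeOf Φ d s = pq
    with hT_def
  have hQ : (∑ s ∈ T, aeval f (Lagrange.basis Finset.univ ev s)) = M.typeProj d pq := by
    refine b.ext fun t => ?_
    rw [sum_aeval_lagrange_basis_apply b f hev hfb T t]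
    by_cases ht : cmTypeOf Φ d t = pq
    · have htT : t ∈ T := Finset.mem_filter.2 ⟨Finset.mem_univ _, ht⟩
      rw [if_pos htT, ← ht, M.typeProj_apply_of_mem (hbt t)]
    · have htT : t ∉ T := fun h => ht (Finset.mem_filter.1 h).2
      rw [if_neg htT, M.typeProj_apply_of_mem_ne ht (hbt t)]
  -- (4) degree count
  rw [← hQ]
  exact sum_aeval_lagrange_basis_mem_span_pow f hev T

/-- **Corollary: every `ℂ`-combination of the type projectors of `Hᵈ(A(ℂ); ℂ)` — in particular the
Hodge grading `∑_{p+q=d} (p - q) π_{(p,q)}` — is a polynomial in `(ι u)^*`** for the separating `u`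
of `exists_typeProj_mem_span_pow` (one `u` for all `d`, all models and all coefficient vectors).
[cite: Milne2020HodgeClassesAV, 1.2 (a)–(b)] [cite: MoonenZarhin1999LowDim, Thm. (3.2)(2)] -/
theorem exists_sum_smul_typeProj_mem_span_pow (hA : IsCMTypeRealisation Φ A ι θ) :
    ∃ u : 𝓞 K, ∀ (d : ℕ) (M : HodgeModel (Module.finrank ℚ K / 2) A.X)
      (w : ↥(Finset.HasAntidiagonal.antidiagonal d) → ℂ),
      (∑ pq, w pq • M.typeProj d pq) ∈ Submodule.span ℂ
        (Set.range fun k : Fin (Fintype.card (Set.powersetCard (K →+* ℂ) d)) =>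
          (complexBetti.map (ι u).hom.hom.hom d).hom ^ (k : ℕ)) := by
  obtain ⟨u, hu⟩ := exists_typeProj_mem_span_pow hA
  exact ⟨u, fun d M w => Submodule.sum_mem _ fun pq _ => Submodule.smul_mem _ _ (hu d M pq)⟩

end CMType

end Literature.AlgebraicGeometry.Pohlmann1968

end
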